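import Literature.InformationTheory.QuantumCodes.QuantumExpanderLTZLemma8
import HarnessLib

/-!
# Quantum expander codes: Leverrier–Tillich–Zémor 2015 Lemma 10 and Theorem 2 — the small-set-flip
# decoder (Algorithm 1, `κ = 0`) corrects every error of weight `< min(γ_A n_A, γ_B n_B)/(3(1 + Δ_B))`
# — PROOF

Topic `Literature/InformationTheory/QuantumCodes` (venture QEC, LADDER-QEC Q3/Q4; step 3 of 3). Source:
LTZ15 = arXiv:1504.00822v1: Lemma 10 and its proof (p0009 L40-75), Thm 2 (p0006 L15-22). Objects: the
small-set-flip decoder of `QuantumExpanderCodes.lean` with threshold `κ = 0` (Algorithm 1: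
"`(|s| − |s₁|)/|e₁|` maximal"), the repaired named fact `LTZ15_theorem2_le` (standing hypotheses
`0 < Δ_A ≤ Δ_B` of §2 made explicit; the unrepaired `LTZ15_theorem2` is refuted in
`QuantumExpanderCodesDegenerate.lean`).

* `ssfRun_zero_corrects` — **LTZ15 Lemma 10, PROVED** as the run invariant
  `|ε| + 3|σ_X(ε)| < min(γ_A n_A, γ_B n_B)` (Lemma 8 + maximality of the chosen flip ⇒
  `|e_{i+1}| ≤ 3(|σ_X(εᵢ)| − |σ_X(εᵢ₊₁)|)`; at the halting syndrome the error is in `C_Z^⊥`);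
* `LTZ15_theorem2_le_holds` — **LTZ15 Theorem 2 (correction clause), PROVED**: discharges the named
  fact `LTZ15_theorem2_le` (`|e| + 3|σ_X(e)| ≤ (1 + 3Δ_B)|e| < min`, column weight `Δ_B` of `H_X`).
-/

namespace Literature.InformationTheory.QuantumCodes

namespace QuantumExpander

open Finset Matrix

variable {A B : Type*} [Fintype A] [Fintype B] [DecidableEq A] [DecidableEq B]

/-- Subadditivity of the Hamming weight. [folklore] -/
private theorem hammingNorm_add_le'' {ι : Type*} [Fintype ι] (x y : ι → ZMod 2) :
    hammingNorm (x + y) ≤ hammingNorm x + hammingNorm y := by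
  have h := hammingDist_triangle (x + y) y 0
  have h1 : hammingDist (x + y) y = hammingNorm x := by
    rw [hammingDist_comm, hammingDist_eq_hammingNorm]
    congr 1; ext i; simp only [Pi.add_apply, Pi.neg_apply]; ring
  rw [hammingDist_zero_right, hammingDist_zero_right, h1] at h
  exact h

/-! ### LTZ15 Lemma 10 and Theorem 2 -/

/-- **LTZ15 Lemma 10 (the induction along a run), PROVED.** Along a complete valid run of Algorithm 1
(`κ = 0`) the invariant `|ε| + 3|σ_X(ε)| < min(γ_A n_A, γ_B n_B)` (a strengthening of eq. (epsilon):
`|εᵢ| ≤ |e| + 3|σ_X(e)|`) is preserved, because by Lemma 8 and the maximality of the chosen flip each step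
satisfies `|e_{i+1}| ≤ 3(|σ_X(εᵢ)| − |σ_X(εᵢ₊₁)|)`; at the halting syndrome the error is therefore in
`C_Z^⊥` (else Lemma 8 exhibits a flip with positive decrease).
[cite: LeverrierTillichZemor2015, Lemma 10 and its proof (arXiv v1 p0009 L40-75)] -/
theorem ssfRun_zero_corrects (H : Matrix B A (ZMod 2)) {dA dB : ℕ} {γA δA γB δB : ℝ}
    (hreg : IsBiregular H dA dB) (hexp : IsLeftRightExpanding H dA dB γA δA γB δB)
    (hdA : 0 < dA) (hdB : 0 < dB) (hδA : 0 < δA) (hδA' : δA < 1 / 6) (hδB : 0 < δB) (hδB' : δB < 1 / 6)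
    {σ : A × B → ZMod 2} {l : List (Finset ((A × A) ⊕ (B × B)))}
    (hrun : IsSSFRun 0 (expanderHX H) (expanderHZ H) σ l) :
    ∀ ε : (A × A) ⊕ (B × B) → ZMod 2, expanderHX H *ᵥ ε = σ →
      (hammingNorm ε : ℝ) + 3 * hammingNorm σ < min (γA * Fintype.card A) (γB * Fintype.card B) →
      ε + runOutput l ∈ rowSpace (expanderHZ H) := by
  classical
  induction hrun with
  | @halt σ hh =>
    intro ε hε hinv
    have hout : runOutput ([] : List (Finset ((A × A) ⊕ (B × B)))) = 0 := by simp [runOutput]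
    rw [hout, add_zero]
    by_contra hnot
    have hw : (hammingNorm ε : ℝ) < min (γA * Fintype.card A) (γB * Fintype.card B) := by
      have : (0 : ℝ) ≤ hammingNorm σ := Nat.cast_nonneg _
      linarith
    obtain ⟨F, hF, hdec⟩ := exists_smallSet_decrease_third H hreg hexp hdA hdB hδA hδA' hδB hδB' ε hnot
      (hw.le.trans (min_le_left _ _)) (hw.le.trans (min_le_right _ _))
    rw [hε] at hdec
    have hFpos : (0 : ℝ) < F.card := by exact_mod_cast card_pos_of_mem_smallSets hF
    have hdpos : 0 < syndromeDecrease (expanderHX H) σ F := by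
      have : (0 : ℝ) < syndromeDecrease (expanderHX H) σ F := by linarith
      exact_mod_cast this
    exact hh F hF ⟨hdpos, by simp; exact_mod_cast hdpos.le⟩
  | @step σ F l hF hrest ih =>
    intro ε hε hinv
    obtain ⟨hFmem, hdecpos, _, hmax⟩ := hF
    -- `ε ∉ C_Z^⊥` (otherwise its syndrome is `0` and no flip decreases it)
    have hnot : ε ∉ rowSpace (expanderHZ H) := by
      intro hmem
      have hσ0 : σ = 0 := by rw [← hε]; exact expanderHX_mulVec_eq_zero_of_mem_rowSpace H hmem
      have : syndromeDecrease (expanderHX H) σ F ≤ 0 := by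
        rw [syndromeDecrease, hσ0]
        simp
      linarith
    have hw : (hammingNorm ε : ℝ) < min (γA * Fintype.card A) (γB * Fintype.card B) := by
      have : (0 : ℝ) ≤ hammingNorm σ := Nat.cast_nonneg _
      linarith
    -- Lemma 8: some flip has ratio `≥ 1/3`; by maximality so has `F`
    obtain ⟨F', hF', hdec'⟩ := exists_smallSet_decrease_third H hreg hexp hdA hdB hδA hδA' hδB hδB' ε
      hnot (hw.le.trans (min_le_left _ _)) (hw.le.trans (min_le_right _ _))
    rw [hε] at hdec'
    have hratio := hmax F' hF'
    have hF'pos : (0 : ℝ) < F'.card := by exact_mod_cast card_pos_of_mem_smallSets hF'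
    have hFpos : (0 : ℝ) < F.card := by exact_mod_cast card_pos_of_mem_smallSets hFmem
    have hthird : (1 : ℝ) / 3 ≤ (syndromeDecrease (expanderHX H) σ F' : ℝ) / F'.card := by
      rw [le_div_iff₀ hF'pos]; linarith
    have hFle : (F.card : ℝ) ≤ 3 * syndromeDecrease (expanderHX H) σ F := by
      have := hthird.trans hratio
      rw [le_div_iff₀ hFpos] at this
      linarith
    -- the invariant for `ε' = ε ⊕ F`
    have hε' : expanderHX H *ᵥ (ε + flipVec F) = σ + expanderHX H *ᵥ flipVec F := by
      rw [Matrix.mulVec_add, hε]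
    have hinv' : (hammingNorm (ε + flipVec F) : ℝ) + 3 * hammingNorm (σ + expanderHX H *ᵥ flipVec F)
        < min (γA * Fintype.card A) (γB * Fintype.card B) := by
      have h1 : (hammingNorm (ε + flipVec F) : ℝ) ≤ hammingNorm ε + F.card := by
        have := hammingNorm_add_le'' ε (flipVec F)
        rw [hammingNorm_flipVec] at this
        exact_mod_cast this
      have h2 : (syndromeDecrease (expanderHX H) σ F : ℝ)
          = hammingNorm σ - hammingNorm (σ + expanderHX H *ᵥ flipVec F) := by
        rw [syndromeDecrease]; push_cast; ring
      rw [h2] at hFle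
      linarith
    have hres := ih (ε + flipVec F) hε' hinv'
    rw [runOutput_cons, ← add_assoc]
    exact hres

/-- **Leverrier–Tillich–Zémor 2015, Theorem 2 (correction clause), PROVED** (discharges the named fact
`LTZ15_theorem2_le`): for a `(Δ_A, Δ_B)`-biregular (`1 ≤ Δ_A ≤ Δ_B`), `(γ_A, δ_A, γ_B, δ_B)`-left-right-
expanding graph with `δ_A, δ_B < 1/6`, EVERY small-set-flip decoder (Algorithm 1: threshold `κ = 0`, any
tie-breaking among ratio-maximising flips) corrects EVERY `X`-error of weight
`< w₀ = min(γ_A n_A, γ_B n_B)/(3(1 + Δ_B))`. Proof: `|e| + 3|σ_X(e)| ≤ (1 + 3Δ_B)|e| < min(γ_A n_A, γ_B n_B)`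
(column weight `Δ_B` of `H_X`, convention `Δ_A ≤ Δ_B`), then Lemma 10.
[cite: LeverrierTillichZemor2015, Thm 2 (arXiv v1 p0006 L15-22) via Lemma 10 (p0009 L40-75)] -/
theorem LTZ15_theorem2_le_holds : LTZ15_theorem2_le := by
  intro A B _ _ _ _ H dA dB γA δA γB δB hreg hexp hdA hdB hle hγA hδA hδA' hγB hδB hδB' D hD e he
  classical
  obtain ⟨l, hrun, hDσ⟩ := hD (expanderHX H *ᵥ e)
  rw [Decoder.Corrects, hDσ, SetLike.mem_coe, add_comm]
  refine ssfRun_zero_corrects H hreg hexp hdA hdB hδA hδA' hδB hδB' hrun e rfl ?_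
  -- `|e| + 3|σ_X(e)| ≤ (1 + 3Δ_B)|e| < (1 + 3Δ_B) w₀ ≤ min`
  set M := min (γA * Fintype.card A) (γB * Fintype.card B) with hM
  have hσ : (hammingNorm (expanderHX H *ᵥ e) : ℝ) ≤ dB * hammingNorm e := by
    exact_mod_cast hammingNorm_expanderHX_mulVec_le H hreg hle e
  have hc : 0 < 1 / (3 * (1 + (dB : ℝ))) := by positivity
  have hM0 : 0 < M := by
    have h0 : (0 : ℝ) ≤ hammingNorm e := Nat.cast_nonneg _
    have h1 : 0 < 1 / (3 * (1 + (dB : ℝ))) * M := lt_of_le_of_lt h0 he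
    by_contra hneg
    push Not at hneg
    have : 1 / (3 * (1 + (dB : ℝ))) * M ≤ 1 / (3 * (1 + (dB : ℝ))) * 0 :=
      mul_le_mul_of_nonneg_left hneg hc.le
    linarith
  have hkey : (1 + 3 * (dB : ℝ)) * (1 / (3 * (1 + (dB : ℝ))) * M) < M := by
    rw [← mul_assoc]
    have : (1 + 3 * (dB : ℝ)) * (1 / (3 * (1 + (dB : ℝ)))) < 1 := by
      rw [mul_one_div, div_lt_one (by positivity)]; linarith
    calc (1 + 3 * (dB : ℝ)) * (1 / (3 * (1 + (dB : ℝ)))) * M < 1 * M :=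
          mul_lt_mul_of_pos_right this hM0
      _ = M := one_mul M
  have h3 : (hammingNorm e : ℝ) + 3 * hammingNorm (expanderHX H *ᵥ e) ≤ (1 + 3 * dB) * hammingNorm e := by
    nlinarith
  have h4 : (1 + 3 * (dB : ℝ)) * hammingNorm e ≤ (1 + 3 * (dB : ℝ)) * (1 / (3 * (1 + (dB : ℝ))) * M) :=
    mul_le_mul_of_nonneg_left he.le (by positivity)
  linarith


/-! ### Appended (qec-type-04 g3): the convention-free form `Δ_B ↦ max(Δ_A, Δ_B)` and the reversed graph

LTZ15 state Theorem 2 under the convention `Δ_A ≤ Δ_B` and treat only `X`-errors ("the other case being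
symmetric", §3). The only use of the convention in the proof is the column-weight bound
`|σ_X(e)| ≤ Δ_B |e|`, which holds unconditionally with `max(Δ_A, Δ_B)`; so the radius
`min(γ_A n_A, γ_B n_B)/(3(1 + max(Δ_A, Δ_B)))` needs no convention, and the `Z`-sector (the same statement
for the reversed graph `Hᵀ`, degrees `(Δ_B, Δ_A)`) follows for EVERY biregular expander, not only when
`Δ_A = Δ_B`. -/

/-- Column weights of `H_X` without the convention: every qubit lies in at most `max(Δ_A, Δ_B)` checks, hence
`|σ_X(e)| ≤ max(Δ_A, Δ_B)·|e|`. [cite: LeverrierTillichZemor2015, proof of Lemma 10 ("the syndrome σ_X(e) has weight at most Δ_B|e|" under Δ_A ≤ Δ_B; arXiv v1 p0009 L64)] -/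
theorem hammingNorm_expanderHX_mulVec_le_max (H : Matrix B A (ZMod 2)) {dA dB : ℕ}
    (hreg : IsBiregular H dA dB) (v : (A × A) ⊕ (B × B) → ZMod 2) :
    hammingNorm (expanderHX H *ᵥ v) ≤ max dA dB * hammingNorm v := by
  classical
  have hcover : (univ.filter fun c : A × B => (expanderHX H *ᵥ v) c ≠ 0)
      ⊆ (supp v).biUnion fun q => univ.filter fun c : A × B => expanderHX H c q ≠ 0 := by
    intro c hc
    rw [Finset.mem_filter] at hc
    by_contra hnot
    apply hc.2
    rw [Matrix.mulVec, dotProduct]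
    refine Finset.sum_eq_zero fun q _ => ?_
    by_cases hq : v q = 0
    · rw [hq, mul_zero]
    · by_cases hH : expanderHX H c q = 0
      · rw [hH, zero_mul]
      · exfalso; apply hnot
        exact Finset.mem_biUnion.2 ⟨q, by simpa [supp] using hq,
          Finset.mem_filter.2 ⟨Finset.mem_univ _, hH⟩⟩
  have hcol : ∀ q : (A × A) ⊕ (B × B),
      (univ.filter fun c : A × B => expanderHX H c q ≠ 0).card ≤ max dA dB := by
    intro q
    rcases q with ⟨α, a'⟩ | ⟨b', β'⟩
    · have hsub : (univ.filter fun c : A × B => expanderHX H c (Sum.inl (α, a')) ≠ 0)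
          ⊆ (nbrs H a').image fun β => (α, β) := by
        rintro ⟨α'', β⟩ hc
        rw [Finset.mem_filter] at hc
        have h := hc.2
        simp only [expanderHX, HypergraphProduct.zMatrix_apply_inl, Matrix.transpose_apply] at h
        have hαα : α'' = α := by
          by_contra hne; exact h (by simp [hne])
        subst hαα
        have hβ : H β a' ≠ 0 := by
          intro h0; exact h (by simp [h0])
        exact Finset.mem_image.2 ⟨β, mem_nbrs.2 hβ, rfl⟩
      calc _ ≤ ((nbrs H a').image fun β => (α, β)).card := Finset.card_le_card hsub
        _ ≤ (nbrs H a').card := Finset.card_image_le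
        _ = dA := card_nbrs_eq H hreg a'
        _ ≤ max dA dB := le_max_left _ _
    · have hsub : (univ.filter fun c : A × B => expanderHX H c (Sum.inr (b', β')) ≠ 0)
          ⊆ (nbrs Hᵀ b').image fun α => (α, β') := by
        rintro ⟨α, β''⟩ hc
        rw [Finset.mem_filter] at hc
        have h := hc.2
        simp only [expanderHX, HypergraphProduct.zMatrix_apply_inr] at h
        have hββ : β'' = β' := by
          by_contra hne; exact h (by simp [hne])
        subst hββ
        have hα : H b' α ≠ 0 := by
          intro h0; exact h (by simp [h0])
        exact Finset.mem_image.2 ⟨α, by rw [mem_nbrs, Matrix.transpose_apply]; exact hα, rfl⟩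
      calc _ ≤ ((nbrs Hᵀ b').image fun α => (α, β')).card := Finset.card_le_card hsub
        _ ≤ (nbrs Hᵀ b').card := Finset.card_image_le
        _ = dB := card_nbrs_transpose_eq H hreg b'
        _ ≤ max dA dB := le_max_right _ _
  have hsupp : (supp v).card = hammingNorm v := by simp [supp, hammingNorm]
  calc hammingNorm (expanderHX H *ᵥ v)
      = (univ.filter fun c : A × B => (expanderHX H *ᵥ v) c ≠ 0).card := by simp [hammingNorm]
    _ ≤ ((supp v).biUnion fun q => univ.filter fun c : A × B => expanderHX H c q ≠ 0).card :=
        Finset.card_le_card hcover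
    _ ≤ ∑ q ∈ supp v, (univ.filter fun c : A × B => expanderHX H c q ≠ 0).card := Finset.card_biUnion_le
    _ ≤ ∑ q ∈ supp v, max dA dB := Finset.sum_le_sum fun q _ => hcol q
    _ = max dA dB * hammingNorm v := by rw [Finset.sum_const, smul_eq_mul, hsupp, mul_comm]

/-- **LTZ15 Theorem 2, convention-free form** (our mild strengthening: `Δ_B` replaced by `max(Δ_A, Δ_B)` in
`w₀`, no hypothesis `Δ_A ≤ Δ_B`): for a `(Δ_A, Δ_B)`-biregular (`Δ ≥ 1`) `(γ_A, δ_A, γ_B, δ_B)`-expanding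
graph with `δ_A, δ_B < 1/6`, every small-set-flip decoder (Algorithm 1) corrects every `X`-error of weight
`< min(γ_A n_A, γ_B n_B)/(3(1 + max(Δ_A, Δ_B)))`. Under the source's convention this is exactly
`LTZ15_theorem2_le_holds`. [cite: LeverrierTillichZemor2015, Thm 2 and Lemma 10 (arXiv v1 p0006 L15-22, p0009 L40-75)] -/
theorem ltz15_theorem2_max (H : Matrix B A (ZMod 2)) {dA dB : ℕ} {γA δA γB δB : ℝ}
    (hreg : IsBiregular H dA dB) (hexp : IsLeftRightExpanding H dA dB γA δA γB δB)
    (hdA : 0 < dA) (hdB : 0 < dB) (hδA : 0 < δA) (hδA' : δA < 1 / 6) (hδB : 0 < δB) (hδB' : δB < 1 / 6)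
    (D : Decoder (A × B → ZMod 2) ((A × A) ⊕ (B × B) → ZMod 2))
    (hD : IsSSFDecoder 0 (expanderHX H) (expanderHZ H) D) (e : (A × A) ⊕ (B × B) → ZMod 2)
    (he : (hammingNorm e : ℝ)
      < 1 / (3 * (1 + (max dA dB : ℕ))) * min (γA * Fintype.card A) (γB * Fintype.card B)) :
    D.Corrects (fun x => expanderHX H *ᵥ x) (rowSpace (expanderHZ H) : Set _) e := by
  classical
  obtain ⟨l, hrun, hDσ⟩ := hD (expanderHX H *ᵥ e)
  rw [Decoder.Corrects, hDσ, SetLike.mem_coe, add_comm]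
  refine ssfRun_zero_corrects H hreg hexp hdA hdB hδA hδA' hδB hδB' hrun e rfl ?_
  set M := min (γA * Fintype.card A) (γB * Fintype.card B) with hM
  set m : ℝ := ((max dA dB : ℕ) : ℝ) with hm
  have hm0 : 0 < m := by rw [hm]; exact_mod_cast lt_max_of_lt_left hdA
  have hσ : (hammingNorm (expanderHX H *ᵥ e) : ℝ) ≤ m * hammingNorm e := by
    rw [hm]; exact_mod_cast hammingNorm_expanderHX_mulVec_le_max H hreg e
  have hc : 0 < 1 / (3 * (1 + m)) := by positivity
  have hM0 : 0 < M := by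
    have h0 : (0 : ℝ) ≤ hammingNorm e := Nat.cast_nonneg _
    have h1 : 0 < 1 / (3 * (1 + m)) * M := lt_of_le_of_lt h0 he
    by_contra hneg
    push Not at hneg
    have : 1 / (3 * (1 + m)) * M ≤ 1 / (3 * (1 + m)) * 0 := mul_le_mul_of_nonneg_left hneg hc.le
    linarith
  have hkey : (1 + 3 * m) * (1 / (3 * (1 + m)) * M) < M := by
    rw [← mul_assoc]
    have : (1 + 3 * m) * (1 / (3 * (1 + m))) < 1 := by
      rw [mul_one_div, div_lt_one (by positivity)]; linarith
    calc (1 + 3 * m) * (1 / (3 * (1 + m))) * M < 1 * M := mul_lt_mul_of_pos_right this hM0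
      _ = M := one_mul M
  have h3 : (hammingNorm e : ℝ) + 3 * hammingNorm (expanderHX H *ᵥ e) ≤ (1 + 3 * m) * hammingNorm e := by
    nlinarith
  have h4 : (1 + 3 * m) * hammingNorm e ≤ (1 + 3 * m) * (1 / (3 * (1 + m)) * M) :=
    mul_le_mul_of_nonneg_left he.le (by positivity)
  linarith

/-- **LTZ15 Theorem 2, `Z`-sector** ("the other case being symmetric"): the statement for the reversed graph
`Hᵀ` (degrees `(Δ_B, Δ_A)`, parameters `(γ_B, δ_B, γ_A, δ_A)`), for EVERY biregular expander — available
because the convention-free form does not need `Δ_B ≤ Δ_A`. [cite: LeverrierTillichZemor2015, Thm 2 and §3 ("it is enough to prove Theorem 2 for error patterns of the form (e_X,0) and (0,e_Z) … the other case being symmetric"; arXiv v1 p0007 L40-44)] -/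
theorem ltz15_theorem2_transpose (H : Matrix B A (ZMod 2)) {dA dB : ℕ} {γA δA γB δB : ℝ}
    (hreg : IsBiregular H dA dB) (hexp : IsLeftRightExpanding H dA dB γA δA γB δB)
    (hdA : 0 < dA) (hdB : 0 < dB) (hδA : 0 < δA) (hδA' : δA < 1 / 6) (hδB : 0 < δB) (hδB' : δB < 1 / 6)
    (D : Decoder (B × A → ZMod 2) ((B × B) ⊕ (A × A) → ZMod 2))
    (hD : IsSSFDecoder 0 (expanderHX Hᵀ) (expanderHZ Hᵀ) D) (e : (B × B) ⊕ (A × A) → ZMod 2)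
    (he : (hammingNorm e : ℝ)
      < 1 / (3 * (1 + (max dA dB : ℕ))) * min (γA * Fintype.card A) (γB * Fintype.card B)) :
    D.Corrects (fun x => expanderHX Hᵀ *ᵥ x) (rowSpace (expanderHZ Hᵀ) : Set _) e := by
  have hregT : IsBiregular Hᵀ dB dA := isBiregular_transpose H hreg
  have hexpT : IsLeftRightExpanding Hᵀ dB dA γB δB γA δA := by
    refine ⟨(isLeftExpanding_transpose_iff H dB γB δB).2 hexp.2, ?_⟩
    have h : IsLeftExpanding Hᵀᵀ dA γA δA := by rw [Matrix.transpose_transpose]; exact hexp.1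
    exact (isLeftExpanding_transpose_iff Hᵀ dA γA δA).1 h
  refine ltz15_theorem2_max Hᵀ hregT hexpT hdB hdA hδB hδB' hδA hδA' D hD e ?_
  rwa [max_comm, min_comm]

end QuantumExpander

end Literature.InformationTheory.QuantumCodes
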